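import Literature.Topology.FourManifolds.LadderCoreConnected
import Literature.Topology.FourManifolds.ThickenedHandlebodyFour
import HarnessLib

/-!
# The bridge slabs of the ladder body `Z = {q + z² + w² ≤ c} ⊂ ℝ⁴`: round tubes, the scaling to
# a straight product, and the slide along the bridges

Topic `Literature/Topology/FourManifolds`; brick E3a of the constructive road (P1′) to
`Literature.Topology.FourManifolds.Trisection.isConnectedSum_of_reducing_separating`
(`ReducibleTrisectionSplitting.lean`, § Status), on top of `LadderMorseFunction.lean` (the
ladder `q = P.ladder`, its level `c = P.level`) and `LadderCore.lean` (`slabCtr i = 4i + 2`).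
The ladder body `Z = {G ≤ c}`, `G(x, y, z, w) = q(x, y) + z² + w²` (`bodyG`), is the model of a
genus-`k` `4`-dimensional `1`-handlebody; across the slab `|x - slabCtr i| ≤ 1/2` of the
`i`-th pair of bridges it is explicit:

* `bodyG_eq_upper`/`bodyG_eq_lower`: `G = τx + |v|²`, `v = (y ∓ 1, z, w)`, for `|y ∓ 1| ≤ 7/8`;
  `level_lt_bodyG_of_upper_off`, `level_lt_bodyG_of_abs_lt`: elsewhere on the slab `G > c`;
  hence `bodyG_le_iff_upper/lower`, `bodyG_eq_iff_upper/lower`: **`Z ∩ slab` is the pair of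
  round solid tubes `τx + |v|² ≤ c`**, `∂Z ∩ slab` the pair of round sphere bundles, of radius
  `R(x) = √(c - τx) ∈ (1/2, 7/8)` (`rad`, `rad_gt`, `rad_lt`);
* `unscaleU`/`scaleU`: the fibrewise scaling `(x, 1 + u) ↔ (x, 1 + R(x) u)` between the straight
  product `slab × 𝔻³` and the upper tube (`bodyG_unscaleU_le_iff`, `bodyG_unscaleU_eq_iff`);
* `slideU t`: **the slide along the upper bridge**, `(x, 1 + v) ↦ (x + t, 1 + v R(x+t)/R(x))`
  (`= unscale ∘ translate ∘ scale`, `slideU_eq`), with `slideU_zero`, the group law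
  `slideU_add`, and `bodyG_slideU_sub`: `G(slide_t p) - c = (R(x+t)/R(x))² (G(p) - c)`, so the
  slide preserves `Z`, `∂Z` and carries the level `3`-balls `{x} × B_{R(x)}` onto each other;
* `reflY`, `bodyG_reflY`: the symmetry `y ↦ -y` exchanging the two tubes.

Everything is **proved** (explicit functions); no named fact is introduced.

## References
* J. Milnor, *Lectures on the h-cobordism theorem* (1965), §3 (product structure across a
  regular slab). [MilnorHCobordism1965]
-/

noncomputable section

open scoped Topology ContDiff Manifold
open Set Filter Real
open Literature.Geometry.Symplectic.LegendrianModel (bump dbump bump_pos bump_eq_zero bump_nonneg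
  bump_le_bump_zero bump_lt_bump bump_le_bump dbump_eq_zero contDiff_bump bump_pos_iff bump_neg dbump_neg)

namespace Literature.Topology.FourManifolds

/-- Local notation: `𝔼 n` is the model Euclidean space `EuclideanSpace ℝ (Fin n)`. -/
local notation "𝔼 " n:arg => EuclideanSpace ℝ (Fin n)

open PlanarThickening SolidThickening Literature.Analysis.Pluripotential

namespace Ladder

/-! ### §1 Points of `ℝ⁴` -/

/-- The point `(a, b, c, d) ∈ ℝ⁴`. [folklore] -/
def pt4 (a b c d : ℝ) : 𝔼 4 := WithLp.toLp 2 ![a, b, c, d]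

/-- Coordinate of the explicit point (definitional). [folklore] -/
@[simp] theorem pt4_apply_zero (a b c d : ℝ) : pt4 a b c d 0 = a := rfl
/-- Coordinate of the explicit point (definitional). [folklore] -/
@[simp] theorem pt4_apply_one (a b c d : ℝ) : pt4 a b c d 1 = b := rfl
/-- Coordinate of the explicit point (definitional). [folklore] -/
@[simp] theorem pt4_apply_two (a b c d : ℝ) : pt4 a b c d 2 = c := rfl
/-- Coordinate of the explicit point (definitional). [folklore] -/
@[simp] theorem pt4_apply_three (a b c d : ℝ) : pt4 a b c d 3 = d := rfl

/-- Every point of `ℝ⁴` is a `pt4`. [folklore] -/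
theorem pt4_eta (p : 𝔼 4) : pt4 (p 0) (p 1) (p 2) (p 3) = p := by
  ext i; fin_cases i <;> rfl

namespace Params

variable {k : ℕ} (P : Params k)

/-! ### §2 The ladder body function `G = q + z² + w²` on the upper bridge slabs -/

/-- **The ladder body function** `G(x, y, z, w) = q(x, y) + z² + w²`. [folklore] -/
abbrev bodyG : 𝔼 4 → ℝ := thicken₄ (thicken P.ladder)

/-- Unfolding of the body function. [folklore] -/
theorem bodyG_apply (p : 𝔼 4) : P.bodyG p = P.ladderFun (p 0) (p 1) + p 2 ^ 2 + p 3 ^ 2 := by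
  rw [show P.bodyG p = thicken₄ (thicken P.ladder) p from rfl, thicken₄_apply, thicken_apply]
  rfl

/-- `c < 3/4` (`c < 1 - b(x₂) < 1 - b(1/2) < 3/4`). [folklore] -/
theorem level_lt_three_quarters : P.level < 3 / 4 := by
  unfold level
  have hz := P.x₂_mem
  have hb : bump (1 / 2) < bump P.x₂ :=
    bump_lt_bump (by rw [abs_of_neg hz.2, abs_of_pos (by norm_num : (0:ℝ) < 1 / 2)]; linarith [hz.1])
      (by rw [abs_of_neg hz.2]; linarith [hz.1])
  linarith [quarter_lt_bump_half, bump_nonneg P.x₁, P.κ_smoothAbs_zero_mem.1]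

/-- **On an upper bridge slab the body function is `τx + (y - 1)² + z² + w²`**
(`|x - slabCtr i| ≤ 1/2`, `|y - 1| ≤ 7/8`). [folklore] -/
theorem bodyG_eq_upper {i : ℕ} (hi : i < k) {p : 𝔼 4} (hx : |p 0 - slabCtr i| ≤ 1 / 2) (hy : |p 1 - 1| ≤ 7 / 8) :
    P.bodyG p = P.τ * p 0 + ((p 1 - 1) ^ 2 + p 2 ^ 2 + p 3 ^ 2) := by
  have hκ := P.κ_le
  have hyy := abs_le.1 hy
  have hbr := P.ladder_eq_bridge hi (x := p 0) (y := p 1) (by unfold slabCtr at hx; exact hx)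
    (by rw [abs_of_pos (by linarith)]; linarith) (by rw [abs_of_pos (by linarith)]; linarith)
  rw [ladder_pt, abs_of_pos (by linarith : (0:ℝ) < p 1)] at hbr
  rw [bodyG_apply, hbr]; ring

/-- **Off the bridge tube, on an upper slab, the body function exceeds the level**: for
`|x - slabCtr i| ≤ 1/2`, `y ≥ 0` and `|y - 1| > 7/8`. [folklore] -/
theorem level_lt_bodyG_of_upper_off {i : ℕ} (hi : i < k) {p : 𝔼 4} (hx : |p 0 - slabCtr i| ≤ 1 / 2)
    (hy0 : 0 ≤ p 1) (hy : 7 / 8 < |p 1 - 1|) : P.level < P.bodyG p := by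
  have hc := P.level_lt_three_quarters
  have hκ := P.κ_pos
  have hκ4 := P.κ_le
  obtain ⟨h1, h2, h3⟩ := slab_hyps hi (x := p 0) (by unfold slabCtr at hx; exact hx)
  have hsq : 0 ≤ p 2 ^ 2 + p 3 ^ 2 := by positivity
  rw [bodyG_apply]
  have hτ := P.τ_pos
  have hτx : 0 ≤ P.τ * p 0 := by nlinarith
  -- three ranges of `y`
  rcases lt_or_ge (p 1) (P.κ / 4) with hlt | hge
  · -- `0 ≤ y < κ/4`: `q > τx + 1 - κ ≥ 3/4`
    have := P.ladderFun_gt_of_abs_lt h1 h2 h3 (by rw [abs_of_nonneg hy0]; exact hlt)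
    linarith
  rcases le_or_gt (p 1) 2 with hle2 | hgt2
  · -- bridge range: `q = τx + (y-1)²` with `|y - 1| > 7/8`
    have hbr := P.ladderFun_eq_bridge h1 h2 h3 (by rw [abs_of_nonneg hy0]; exact hge)
      (by rw [abs_of_nonneg hy0]; exact hle2)
    rw [abs_of_nonneg hy0] at hbr
    rw [hbr]
    have : (7 / 8 : ℝ) ^ 2 < (p 1 - 1) ^ 2 := by
      have := sq_lt_sq' (by linarith [abs_nonneg (p 1 - 1)]) hy
      simpa [sq_abs] using this
    nlinarith
  · -- `y > 2`: `q ≥ (y - 1)² - κ/2`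
    unfold ladderFun
    have hs : sFun k (p 0) = 1 := sFun_eq_one h1 h3
    rw [hs, barrier_of_nonpos (by linarith : -(p 0) ≤ 0), barrier_of_nonpos (by linarith : p 0 - xR k ≤ 0),
      barrier_of_nonpos (by linarith : -(p 1) - 2 ≤ 0)]
    have hS := smoothAbs_le_abs_add_one (4 * 1 * p 1 / P.κ)
    rw [abs_of_pos (by positivity)] at hS
    have hp := barrier_nonneg (p 1 - 2)
    have e : P.κ / 2 * (4 * 1 * p 1 / P.κ + 1) = 2 * p 1 + P.κ / 2 := by field_simp; ring
    have h5 : P.κ / 2 * smoothAbs (4 * 1 * p 1 / P.κ) ≤ 2 * p 1 + P.κ / 2 := by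
      rw [← e]; exact mul_le_mul_of_nonneg_left hS (by linarith)
    nlinarith

/-- **Membership in the ladder body on an upper slab**: `G ≤ c ↔ τx + |v|² ≤ c`,
`v = (y - 1, z, w)` (`|x - slabCtr i| ≤ 1/2`, `y ≥ 0`). [folklore] -/
theorem bodyG_le_iff_upper {i : ℕ} (hi : i < k) {p : 𝔼 4} (hx : |p 0 - slabCtr i| ≤ 1 / 2) (hy0 : 0 ≤ p 1) :
    P.bodyG p ≤ P.level ↔ P.τ * p 0 + ((p 1 - 1) ^ 2 + p 2 ^ 2 + p 3 ^ 2) ≤ P.level := by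
  have hc := P.level_lt_three_quarters
  obtain ⟨h1, -, -⟩ := slab_hyps hi (x := p 0) (by unfold slabCtr at hx; exact hx)
  have hτx : 0 ≤ P.τ * p 0 := by nlinarith [P.τ_pos]
  constructor
  · intro h
    rcases le_or_gt |p 1 - 1| (7 / 8) with hy | hy
    · rwa [P.bodyG_eq_upper hi hx hy] at h
    · exact absurd h (not_le.2 (P.level_lt_bodyG_of_upper_off hi hx hy0 hy))
  · intro h
    have hy : |p 1 - 1| ≤ 7 / 8 := by
      rw [abs_le]
      constructor <;> nlinarith [sq_nonneg (p 2), sq_nonneg (p 3)]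
    rwa [P.bodyG_eq_upper hi hx hy]

/-- **Membership in the boundary of the ladder body on an upper slab**: `G = c ↔ τx + |v|² = c`.
[folklore] -/
theorem bodyG_eq_iff_upper {i : ℕ} (hi : i < k) {p : 𝔼 4} (hx : |p 0 - slabCtr i| ≤ 1 / 2) (hy0 : 0 ≤ p 1) :
    P.bodyG p = P.level ↔ P.τ * p 0 + ((p 1 - 1) ^ 2 + p 2 ^ 2 + p 3 ^ 2) = P.level := by
  have hc := P.level_lt_three_quarters
  obtain ⟨h1, -, -⟩ := slab_hyps hi (x := p 0) (by unfold slabCtr at hx; exact hx)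
  have hτx : 0 ≤ P.τ * p 0 := by nlinarith [P.τ_pos]
  constructor
  · intro h
    rcases le_or_gt |p 1 - 1| (7 / 8) with hy | hy
    · rwa [P.bodyG_eq_upper hi hx hy] at h
    · exact absurd h.le (not_le.2 (P.level_lt_bodyG_of_upper_off hi hx hy0 hy))
  · intro h
    have hy : |p 1 - 1| ≤ 7 / 8 := by
      rw [abs_le]
      constructor <;> nlinarith [sq_nonneg (p 2), sq_nonneg (p 3)]
    rwa [P.bodyG_eq_upper hi hx hy]


/-! #### The lower bridge slabs, by the symmetry `y ↦ -y` -/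

/-- The reflection `(x, y, z, w) ↦ (x, -y, z, w)`. [folklore] -/
def reflY (p : 𝔼 4) : 𝔼 4 := pt4 (p 0) (-p 1) (p 2) (p 3)

/-- Coordinate of the explicit point (definitional). [folklore] -/
@[simp] theorem reflY_apply_zero (p : 𝔼 4) : reflY p 0 = p 0 := rfl
/-- Coordinate of the explicit point (definitional). [folklore] -/
@[simp] theorem reflY_apply_one (p : 𝔼 4) : reflY p 1 = -p 1 := rfl
/-- Coordinate of the explicit point (definitional). [folklore] -/
@[simp] theorem reflY_apply_two (p : 𝔼 4) : reflY p 2 = p 2 := rfl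
/-- Coordinate of the explicit point (definitional). [folklore] -/
@[simp] theorem reflY_apply_three (p : 𝔼 4) : reflY p 3 = p 3 := rfl

/-- **The body function is even in `y`.** [folklore] -/
theorem bodyG_reflY (p : 𝔼 4) : P.bodyG (reflY p) = P.bodyG p := by
  rw [bodyG_apply, bodyG_apply]; simp [P.ladderFun_neg]

/-- **On a lower bridge slab the body function is `τx + (y + 1)² + z² + w²`**
(`|x - slabCtr i| ≤ 1/2`, `|y + 1| ≤ 7/8`). [folklore] -/
theorem bodyG_eq_lower {i : ℕ} (hi : i < k) {p : 𝔼 4} (hx : |p 0 - slabCtr i| ≤ 1 / 2) (hy : |p 1 + 1| ≤ 7 / 8) :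
    P.bodyG p = P.τ * p 0 + ((p 1 + 1) ^ 2 + p 2 ^ 2 + p 3 ^ 2) := by
  rw [← P.bodyG_reflY, P.bodyG_eq_upper hi (p := reflY p) (by simpa using hx)
    (by simp only [reflY_apply_one]; rw [show -p 1 - 1 = -(p 1 + 1) by ring, abs_neg]; exact hy)]
  simp only [reflY_apply_zero, reflY_apply_one, reflY_apply_two, reflY_apply_three]; ring

/-- **Membership in the ladder body on a lower slab**: `G ≤ c ↔ τx + |v|² ≤ c`,
`v = (y + 1, z, w)` (`y ≤ 0`). [folklore] -/
theorem bodyG_le_iff_lower {i : ℕ} (hi : i < k) {p : 𝔼 4} (hx : |p 0 - slabCtr i| ≤ 1 / 2) (hy0 : p 1 ≤ 0) :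
    P.bodyG p ≤ P.level ↔ P.τ * p 0 + ((p 1 + 1) ^ 2 + p 2 ^ 2 + p 3 ^ 2) ≤ P.level := by
  rw [← P.bodyG_reflY, P.bodyG_le_iff_upper hi (p := reflY p) (by simpa using hx) (by simp; linarith)]
  simp only [reflY_apply_zero, reflY_apply_one, reflY_apply_two, reflY_apply_three]
  rw [show (-p 1 - 1) ^ 2 = (p 1 + 1) ^ 2 by ring]

/-- **Membership in the boundary on a lower slab**: `G = c ↔ τx + |v|² = c`. [folklore] -/
theorem bodyG_eq_iff_lower {i : ℕ} (hi : i < k) {p : 𝔼 4} (hx : |p 0 - slabCtr i| ≤ 1 / 2) (hy0 : p 1 ≤ 0) :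
    P.bodyG p = P.level ↔ P.τ * p 0 + ((p 1 + 1) ^ 2 + p 2 ^ 2 + p 3 ^ 2) = P.level := by
  rw [← P.bodyG_reflY, P.bodyG_eq_iff_upper hi (p := reflY p) (by simpa using hx) (by simp; linarith)]
  simp only [reflY_apply_zero, reflY_apply_one, reflY_apply_two, reflY_apply_three]
  rw [show (-p 1 - 1) ^ 2 = (p 1 + 1) ^ 2 by ring]

/-- **The ladder body does not meet the middle of a slab**: for `|x - slabCtr i| ≤ 1/2` and
`|y| < 1/8`, `G > c`. [folklore] -/
theorem level_lt_bodyG_of_abs_lt {i : ℕ} (hi : i < k) {p : 𝔼 4} (hx : |p 0 - slabCtr i| ≤ 1 / 2)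
    (hy : |p 1| < 1 / 8) : P.level < P.bodyG p := by
  rcases le_or_gt 0 (p 1) with h0 | h0
  · exact P.level_lt_bodyG_of_upper_off hi hx h0 (by rw [abs_of_nonneg h0] at hy; rw [abs_of_neg (by linarith)]; linarith)
  · rw [← P.bodyG_reflY]
    refine P.level_lt_bodyG_of_upper_off hi (p := reflY p) (by simpa using hx) (by simp; linarith) ?_
    simp only [reflY_apply_one]
    rw [abs_of_neg h0] at hy
    rw [abs_of_neg (by linarith)]; linarith

/-! ### §3 The radius of the bridge tube and the scaling maps -/

/-- The squared radius `R(x)² = c - τ x` of the level `3`-ball of the body over `x`. [folklore] -/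
def radSq (x : ℝ) : ℝ := P.level - P.τ * x

/-- The radius `R(x) = √(c - τx)`. [folklore] -/
def rad (x : ℝ) : ℝ := Real.sqrt (P.radSq x)

/-- `R² > 1/4` for `x ≤ x_R + 1`. [folklore] -/
theorem radSq_gt {x : ℝ} (hx : x ≤ xR k + 1) : 1 / 4 < P.radSq x := by
  unfold radSq
  have h1 := P.level_gt'
  have h2 := P.τ_mul_xR_le
  have h3 := P.τ_le
  have hτ := P.τ_pos
  nlinarith

/-- `R > 1/2` for `x ≤ x_R + 1`. [folklore] -/
theorem rad_gt {x : ℝ} (hx : x ≤ xR k + 1) : 1 / 2 < P.rad x := by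
  unfold rad
  rw [show (1 / 2 : ℝ) = Real.sqrt (1 / 4) by rw [show (1/4 : ℝ) = (1/2)^2 by norm_num, Real.sqrt_sq (by norm_num)]]
  exact Real.sqrt_lt_sqrt (by norm_num) (P.radSq_gt hx)

/-- `R > 0` for `x ≤ x_R + 1`. [folklore] -/
theorem rad_pos {x : ℝ} (hx : x ≤ xR k + 1) : 0 < P.rad x := by linarith [P.rad_gt hx]

/-- `R² = c - τx` (the square of the square root). [folklore] -/
theorem rad_sq {x : ℝ} (hx : x ≤ xR k + 1) : P.rad x ^ 2 = P.radSq x :=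
  Real.sq_sqrt (by linarith [P.radSq_gt hx])

/-- `R < 7/8` (`R² = c - τx < 3/4 < 49/64`). [folklore] -/
theorem rad_lt {x : ℝ} (hx0 : 0 ≤ x) (hx : x ≤ xR k + 1) : P.rad x < 7 / 8 := by
  have h := P.rad_sq hx
  have hc := P.level_lt_three_quarters
  have hτ := P.τ_pos
  have hR := P.rad_pos hx
  unfold radSq at h
  nlinarith

/-- `R` is smooth on `x < x_R + 1`… precisely at every `x ≤ x_R + 1`. [folklore] -/
theorem contDiffAt_rad {x : ℝ} (hx : x ≤ xR k + 1) : ContDiffAt ℝ ∞ P.rad x := by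
  unfold rad radSq
  refine (contDiffAt_const.sub (contDiffAt_const.mul contDiffAt_id)).sqrt ?_
  have := P.radSq_gt hx
  unfold radSq at this
  simp only [id]; linarith

/-- **The unscaling map** `(x, 1 + u₀, u₁, u₂) ↦ (x, 1 + R(x) u₀, R(x) u₁, R(x) u₂)`: the straight
product over the slab onto the bridge tube. [folklore] -/
def unscaleU (p : 𝔼 4) : 𝔼 4 := pt4 (p 0) (1 + P.rad (p 0) * (p 1 - 1)) (P.rad (p 0) * p 2) (P.rad (p 0) * p 3)

/-- **The scaling map** `(x, 1 + v₀, v₁, v₂) ↦ (x, 1 + v₀/R(x), v₁/R(x), v₂/R(x))`. [folklore] -/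
def scaleU (p : 𝔼 4) : 𝔼 4 := pt4 (p 0) (1 + (p 1 - 1) / P.rad (p 0)) (p 2 / P.rad (p 0)) (p 3 / P.rad (p 0))

/-- Coordinate of the explicit point (definitional). [folklore] -/
@[simp] theorem unscaleU_apply_zero (p : 𝔼 4) : P.unscaleU p 0 = p 0 := rfl
/-- Coordinate of the explicit point (definitional). [folklore] -/
@[simp] theorem scaleU_apply_zero (p : 𝔼 4) : P.scaleU p 0 = p 0 := rfl

/-- `scale ∘ unscale = id` over `x ≤ x_R + 1`. [folklore] -/
theorem scaleU_unscaleU {p : 𝔼 4} (hx : p 0 ≤ xR k + 1) : P.scaleU (P.unscaleU p) = p := by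
  have hR := (P.rad_pos hx).ne'
  unfold scaleU unscaleU
  ext i; fin_cases i
  · rfl
  · show 1 + (1 + P.rad (p 0) * (p 1 - 1) - 1) / P.rad (p 0) = p 1
    field_simp; ring
  · show P.rad (p 0) * p 2 / P.rad (p 0) = p 2
    field_simp
  · show P.rad (p 0) * p 3 / P.rad (p 0) = p 3
    field_simp

/-- `unscale ∘ scale = id` over `x ≤ x_R + 1`. [folklore] -/
theorem unscaleU_scaleU {p : 𝔼 4} (hx : p 0 ≤ xR k + 1) : P.unscaleU (P.scaleU p) = p := by
  have hR := (P.rad_pos hx).ne'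
  unfold scaleU unscaleU
  ext i; fin_cases i
  · rfl
  · show 1 + P.rad (p 0) * (1 + (p 1 - 1) / P.rad (p 0) - 1) = p 1
    field_simp; ring
  · show P.rad (p 0) * (p 2 / P.rad (p 0)) = p 2
    field_simp
  · show P.rad (p 0) * (p 3 / P.rad (p 0)) = p 3
    field_simp

/-- **The body function in the straight coordinates**: on an upper slab, for `|u₀| ≤ 1`,
`G(unscale p) = τ x + R(x)² |u|²`. [folklore] -/
theorem bodyG_unscaleU {i : ℕ} (hi : i < k) {p : 𝔼 4} (hx : |p 0 - slabCtr i| ≤ 1 / 2) (hu : |p 1 - 1| ≤ 1) :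
    P.bodyG (P.unscaleU p) = P.τ * p 0 + P.radSq (p 0) * ((p 1 - 1) ^ 2 + p 2 ^ 2 + p 3 ^ 2) := by
  obtain ⟨h1, h2, -⟩ := slab_hyps hi (x := p 0) (by unfold slabCtr at hx; exact hx)
  have hxR : p 0 ≤ xR k + 1 := by linarith
  have hR := P.rad_lt (by linarith) hxR
  have hR0 := P.rad_pos hxR
  have hy : |P.unscaleU p 1 - 1| ≤ 7 / 8 := by
    show |1 + P.rad (p 0) * (p 1 - 1) - 1| ≤ 7 / 8
    rw [show 1 + P.rad (p 0) * (p 1 - 1) - 1 = P.rad (p 0) * (p 1 - 1) by ring, abs_mul, abs_of_pos hR0]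
    nlinarith [abs_nonneg (p 1 - 1)]
  rw [P.bodyG_eq_upper hi (p := P.unscaleU p) (by simpa using hx) hy]
  simp only [unscaleU, pt4_apply_zero, pt4_apply_one, pt4_apply_two, pt4_apply_three]
  rw [← P.rad_sq hxR]; ring

/-- **The ladder body is the unit ball bundle in the straight coordinates**: for `|u₀| ≤ 1`,
`G(unscale p) ≤ c ↔ |u| ≤ 1`. [folklore] -/
theorem bodyG_unscaleU_le_iff {i : ℕ} (hi : i < k) {p : 𝔼 4} (hx : |p 0 - slabCtr i| ≤ 1 / 2) (hu : |p 1 - 1| ≤ 1) :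
    P.bodyG (P.unscaleU p) ≤ P.level ↔ (p 1 - 1) ^ 2 + p 2 ^ 2 + p 3 ^ 2 ≤ 1 := by
  obtain ⟨h1, h2, -⟩ := slab_hyps hi (x := p 0) (by unfold slabCtr at hx; exact hx)
  have hpos : 0 < P.radSq (p 0) := by linarith [P.radSq_gt (show p 0 ≤ xR k + 1 by linarith)]
  rw [P.bodyG_unscaleU hi hx hu]
  unfold radSq at *
  constructor
  · intro h; nlinarith
  · intro h; nlinarith

/-- **Its boundary is the unit sphere bundle**: `G(unscale p) = c ↔ |u| = 1`. [folklore] -/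
theorem bodyG_unscaleU_eq_iff {i : ℕ} (hi : i < k) {p : 𝔼 4} (hx : |p 0 - slabCtr i| ≤ 1 / 2) (hu : |p 1 - 1| ≤ 1) :
    P.bodyG (P.unscaleU p) = P.level ↔ (p 1 - 1) ^ 2 + p 2 ^ 2 + p 3 ^ 2 = 1 := by
  obtain ⟨h1, h2, -⟩ := slab_hyps hi (x := p 0) (by unfold slabCtr at hx; exact hx)
  have hpos : 0 < P.radSq (p 0) := by linarith [P.radSq_gt (show p 0 ≤ xR k + 1 by linarith)]
  rw [P.bodyG_unscaleU hi hx hu]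
  unfold radSq at *
  constructor
  · intro h
    have : (P.level - P.τ * p 0) * ((p 1 - 1) ^ 2 + p 2 ^ 2 + p 3 ^ 2 - 1) = 0 := by linarith
    rcases mul_eq_zero.1 this with h' | h'
    · linarith
    · linarith
  · intro h; rw [h]; ring

/-! ### §4 The sliding maps: translate in `x`, rescale the fibre -/

/-- **The slide** by `t` along the upper bridge: `(x, 1 + v) ↦ (x + t, 1 + v R(x + t)/R(x))`.
[folklore] -/
def slideU (t : ℝ) (p : 𝔼 4) : 𝔼 4 :=
  pt4 (p 0 + t) (1 + (p 1 - 1) * (P.rad (p 0 + t) / P.rad (p 0))) (p 2 * (P.rad (p 0 + t) / P.rad (p 0)))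
    (p 3 * (P.rad (p 0 + t) / P.rad (p 0)))

/-- Coordinate of the explicit point (definitional). [folklore] -/
@[simp] theorem slideU_apply_zero (t : ℝ) (p : 𝔼 4) : P.slideU t p 0 = p 0 + t := rfl

/-- The slide is `unscale ∘ (translate) ∘ scale`. [folklore] -/
theorem slideU_eq (t : ℝ) (p : 𝔼 4) :
    P.slideU t p = P.unscaleU (P.scaleU p + t • EuclideanSpace.single 0 1) := by
  unfold slideU unscaleU scaleU
  ext i; fin_cases i <;> simp [pt4] <;> ring

/-- `slide 0 = id` (over `x ≤ x_R + 1`). [folklore] -/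
theorem slideU_zero {p : 𝔼 4} (hx : p 0 ≤ xR k + 1) : P.slideU 0 p = p := by
  have hR := (P.rad_pos hx).ne'
  unfold slideU
  rw [add_zero, div_self hR]
  ext i; fin_cases i <;> simp

/-- **The group law** `slide (s + t) = slide t ∘ slide s` (radii positive). [folklore] -/
theorem slideU_add {s t : ℝ} {p : 𝔼 4} (hx : p 0 ≤ xR k + 1) (hxs : p 0 + s ≤ xR k + 1) :
    P.slideU (s + t) p = P.slideU t (P.slideU s p) := by
  have hR := (P.rad_pos hx).ne'
  have hRs := (P.rad_pos hxs).ne'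
  unfold slideU
  ext i; fin_cases i
  · show p 0 + (s + t) = p 0 + s + t; ring
  · show 1 + (p 1 - 1) * (P.rad (p 0 + (s + t)) / P.rad (p 0)) =
      1 + (1 + (p 1 - 1) * (P.rad (p 0 + s) / P.rad (p 0)) - 1) * (P.rad (p 0 + s + t) / P.rad (p 0 + s))
    rw [show p 0 + (s + t) = p 0 + s + t by ring]; field_simp; ring
  · show p 2 * (P.rad (p 0 + (s + t)) / P.rad (p 0)) = p 2 * (P.rad (p 0 + s) / P.rad (p 0)) * (P.rad (p 0 + s + t) / P.rad (p 0 + s))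
    rw [show p 0 + (s + t) = p 0 + s + t by ring]; field_simp
  · show p 3 * (P.rad (p 0 + (s + t)) / P.rad (p 0)) = p 3 * (P.rad (p 0 + s) / P.rad (p 0)) * (P.rad (p 0 + s + t) / P.rad (p 0 + s))
    rw [show p 0 + (s + t) = p 0 + s + t by ring]; field_simp

/-- **The slide preserves the levels of the body function across an upper slab**: if `p` and
`slide t p` both lie over the slab and `|y - 1| ≤ R(x)` (inside the closed tube), then
`G(slide t p) - c = (R(x+t)/R(x))² (G(p) - c)`; in particular the boundary `{G = c}` and the
body `{G ≤ c}` are preserved. [folklore] -/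
theorem bodyG_slideU_sub {i : ℕ} (hi : i < k) {t : ℝ} {p : 𝔼 4} (hx : |p 0 - slabCtr i| ≤ 1 / 2)
    (hxt : |p 0 + t - slabCtr i| ≤ 1 / 2) (hv : (p 1 - 1) ^ 2 + p 2 ^ 2 + p 3 ^ 2 ≤ P.radSq (p 0)) :
    P.bodyG (P.slideU t p) - P.level = (P.radSq (p 0 + t) / P.radSq (p 0)) * (P.bodyG p - P.level) := by
  obtain ⟨h1, h2, -⟩ := slab_hyps hi (x := p 0) (by unfold slabCtr at hx; exact hx)
  obtain ⟨h1t, h2t, -⟩ := slab_hyps hi (x := p 0 + t) (by unfold slabCtr at hxt; exact hxt)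
  have hxR : p 0 ≤ xR k + 1 := by linarith
  have hxRt : p 0 + t ≤ xR k + 1 := by linarith
  have hR0 := P.rad_pos hxR
  have hRt0 := P.rad_pos hxRt
  have hRlt := P.rad_lt (by linarith) hxR
  have hRtlt := P.rad_lt (by linarith) hxRt
  have hsq := P.rad_sq hxR
  have hsqt := P.rad_sq hxRt
  -- `|y - 1| ≤ R(x) < 7/8` at `p`, and `|y' - 1| = |y - 1| R(x+t)/R(x) ≤ R(x + t) < 7/8` at the slide
  have hy1 : (p 1 - 1) ^ 2 ≤ P.rad (p 0) ^ 2 := by nlinarith [sq_nonneg (p 2), sq_nonneg (p 3)]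
  have hy : |p 1 - 1| ≤ 7 / 8 := by
    have : |p 1 - 1| ≤ P.rad (p 0) := abs_le_of_sq_le_sq' hy1 hR0.le |> fun h => abs_le.2 h
    linarith
  have hy' : |P.slideU t p 1 - 1| ≤ 7 / 8 := by
    show |1 + (p 1 - 1) * (P.rad (p 0 + t) / P.rad (p 0)) - 1| ≤ 7 / 8
    rw [show 1 + (p 1 - 1) * (P.rad (p 0 + t) / P.rad (p 0)) - 1 = (p 1 - 1) * (P.rad (p 0 + t) / P.rad (p 0)) by ring,
      abs_mul, abs_div, abs_of_pos hR0, abs_of_pos hRt0]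
    have h3 : |p 1 - 1| ≤ P.rad (p 0) := abs_le_of_sq_le_sq' hy1 hR0.le |> fun h => abs_le.2 h
    calc |p 1 - 1| * (P.rad (p 0 + t) / P.rad (p 0)) ≤ P.rad (p 0) * (P.rad (p 0 + t) / P.rad (p 0)) := by
          gcongr
      _ = P.rad (p 0 + t) := by field_simp
      _ ≤ 7 / 8 := hRtlt.le
  rw [P.bodyG_eq_upper hi (p := P.slideU t p) (by simpa using hxt) hy', P.bodyG_eq_upper hi hx hy]
  simp only [slideU, pt4_apply_zero, pt4_apply_one, pt4_apply_two, pt4_apply_three]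
  rw [← hsq, ← hsqt]
  unfold radSq at hsq hsqt
  set R := P.rad (p 0)
  set R' := P.rad (p 0 + t)
  have hR : R ≠ 0 := hR0.ne'
  have e1 : P.τ * p 0 = P.level - R ^ 2 := by linarith
  have e2 : P.τ * (p 0 + t) = P.level - R' ^ 2 := by linarith
  rw [e1, e2]
  field_simp
  ring

end Params

end Ladder

end Literature.Topology.FourManifolds
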